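import Summits.MatrixMultiplication.OmegaCensus.STPPVosperSlackTwoSoundG

/-!
# ω-census (abelian STPP census): the SLACK-4 partition law modulo its structure-free cell (table form, any number of blocks)

HONEST FRAMING (pub-omega census; verbatim): lottery ticket; floor = certified bounds/negative ranges.
Census STRUCTURE (seat pub-omega-stpp-1 gen 33, 2026-08-28), family (b2).  The law for leaves with N18-slack FOUR — the fifth open ℤ₆₁ leaf
`{(2,2,2),(3,3,3),(3,3,3)}` read at a `(3,3,3)` block (`z + b + vol + a + L = 13 + 3 + 27 + 3 + 13 = 59 = 61 − 2`; HOME `pub-omega-stpp-1-g33/FIFTH-LEAF.md`).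
The dual chain (`card_SY_add_card_T_le_of_slack`, stpp-1 g32) gives `δ₁ + δ₂′ ≤ 4` for `δ₁ = #SY − (a+L−1)`, `δ₂′ = #T − (b+z−1)`; with Cauchy–Davenport
there are FIVE cells: `δ₁ = 0` / `δ₂′ = 0` (Vosper: rows `caseADeadT`, soundness `caseADeadT_false_of_isAP`), `δ₁ = 1` / `δ₂′ = 1` (Hamidoune–Rødseth:
rows of the general checker `caseGDeadT` over the hole pairs `(h′, k)`, soundness `caseGDeadT_false_of_HR`, `STPPVosperSlackTwoSoundG.lean`), and the
STRUCTURE-FREE cell `(δ₁, δ₂′) = (2, 2)` (exact partition, both pairs two above Cauchy–Davenport with 3-element sets — no inverse theorem in print),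
which this theorem takes as an HYPOTHESIS `h22` about the family (python ×1: the cell is empty for the fifth leaf via the (3,13)@61 two-above zoo; its
kernel certification is the successor's item).  `no_isSTPP_of_slack_four_tables_of_cell22`: the four row families + dead tables + `h22` are contradictory.
UNCONDITIONAL given `hHR` (tree theorem `hamidouneRodsethInverseTheorem_holds`) and `h22`; no `decide`.  Nothing here is progress on `ω`.

References: H. Cohn, R. Kleinberg, B. Szegedy, C. Umans, FOCS 2005 (arXiv:math/0511460), Def. 5.1; A. G. Vosper, J. London Math. Soc. 31 (1956);
Y. O. Hamidoune, Ø. J. Rødseth, Acta Arith. 92 (2000).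
-/

open Finset
open scoped Pointwise

namespace Summit.MatrixMultiplication.OmegaCensus.CubeNB.S2

open Literature.Computability.AlgebraicComplexity
open Literature.Combinatorics.Additive
open Summit.MatrixMultiplication.OmegaCensus.STPPKneser
open Summit.MatrixMultiplication.OmegaCensus.CubeNB.Bits

variable {p : ℕ} [hp : Fact p.Prime]

/-! ## §1 The two structured cell types as contradictions -/

/-- **Vosper cell ⇒ contradiction** (any slack): `Aᵢ`, `Y°` progressions of a common non-zero difference, rows `dihedralSmaller ∨ caseADeadT` over the
free shapes of `Bᵢ`, dead table. [cite: CohnKleinbergSzegedyUmans2005, Def. 5.1] [cite: Vosper1956, main theorem; Nathanson1996, Thm 2.7] -/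
theorem false_of_isAP_rowsA {N : ℕ} {A B C : Fin N → Finset (ZMod p)} (hS : IsSTPP A B C)
    (hA : ∀ k, (A k).Nonempty) (hB : ∀ k, (B k).Nonempty) (hC : ∀ k, (C k).Nonempty) (i : Fin N)
    (hI : ((univ : Finset (Fin N)).erase i).Nonempty) {a b c L z : ℕ} (ha : #(A i) = a) (hb : #(B i) = b) (hc : #(C i) = c)
    (hz : ∑ k ∈ univ.erase i, #(A k) * #(C k) = z) (hL : ∑ k ∈ univ.erase i, #(B k) * #(C k) = L) (hap : a + L ≤ p)
    {d : ZMod p} (hd : d ≠ 0) (hAP : IsAP (A i) d) (hYAP : IsAP (DU B C (univ.erase i)) d)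
    (ks : List (Fin N)) (hks : ks.Nodup) (hksi : ∀ k, k ∈ ks ↔ k ≠ i) {szs : List (ℕ × ℕ × ℕ)}
    (hszs : ks.map (fun k => (#(A k), #(B k), #(C k))) = szs)
    {tbl : List (List ℕ × List ℕ)} (hdead : ∀ e ∈ tbl, CoverDead p N i szs e.1 e.2)
    (rows : ∀ Q ∈ qShapes p b 0 ((p - 1).choose (b - 1)), dihedralSmaller p Q = true ∨ caseADeadT p a c L z Q tbl = true) : False := by
  obtain ⟨β₀, hβ₀, ε, hε, hmin⟩ := exists_dihedralSmaller_false (hB i) d⁻¹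
  have hεd : (ε * d) ≠ 0 := mul_ne_zero (by rcases hε with rfl | rfl <;> simp) hd
  have hAP' : IsAP (A i) (ε * d) := by
    rcases hε with rfl | rfl
    · rwa [one_mul]
    · rw [neg_one_mul]; exact IsAP.neg_diff hAP
  have hYAP' : IsAP (DU B C (univ.erase i)) (ε * d) := by
    rcases hε with rfl | rfl
    · rwa [one_mul]
    · rw [neg_one_mul]; exact IsAP.neg_diff hYAP
  have hinv : (ε * d)⁻¹ = ε * d⁻¹ := by
    rcases hε with rfl | rfl
    · rw [one_mul, one_mul]
    · rw [neg_one_mul, neg_one_mul, inv_neg]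
  have key := caseADeadT_false_of_isAP hS hA hB hC i hI ha hc hz hL hap hεd hAP' hYAP' β₀ ks hks hksi hszs hdead
  rw [hinv] at key
  have hu0 : ε * d⁻¹ ≠ 0 := by rw [← hinv]; exact inv_ne_zero hεd
  rcases rows _ (valShape_mem_qShapes hu0 hβ₀ hb) with h | h
  · rw [hmin] at h; exact Bool.noConfusion h
  · rw [key] at h; exact Bool.noConfusion h

/-- **Hamidoune–Rødseth cell ⇒ contradiction** (any slack): `Aᵢ ⊆` an `(a+1)`-progression and `Y° ⊆` an `(L+1)`-progression of a common non-zero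
difference, `#SY = a + L < p`, rows `dihedralSmaller ∨ caseGDeadT … (a+L) ([0,a]∖{h′}) ((a+[0,L])∖{a+k})` over all hole pairs and free shapes, dead table.
[cite: CohnKleinbergSzegedyUmans2005, Def. 5.1] [cite: HamidouneRodseth2000, main theorem (§1, p. 252)] -/
theorem false_of_HR_rowsA1 {N : ℕ} {A B C : Fin N → Finset (ZMod p)} (hS : IsSTPP A B C)
    (hA : ∀ k, (A k).Nonempty) (hB : ∀ k, (B k).Nonempty) (hC : ∀ k, (C k).Nonempty) (i : Fin N)
    {a b c L z : ℕ} (ha : #(A i) = a) (hb : #(B i) = b) (hc : #(C i) = c)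
    (hz : ∑ k ∈ univ.erase i, #(A k) * #(C k) = z) (hL : ∑ k ∈ univ.erase i, #(B k) * #(C k) = L) (haL : a + L < p)
    (h1a : 1 ≤ a) (h1L : 1 ≤ L)
    {d sA tY : ZMod p} (hd : d ≠ 0) (hAsub : A i ⊆ apFinset sA d (a + 1)) (hYsub : DU B C (univ.erase i) ⊆ apFinset tY d (L + 1))
    (hSY : #((A i).image (fun x => (0 : ZMod p) - x) + DU B C (univ.erase i)) = a + L)
    (ks : List (Fin N)) (hks : ks.Nodup) (hksi : ∀ k, k ∈ ks ↔ k ≠ i) {szs : List (ℕ × ℕ × ℕ)}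
    (hszs : ks.map (fun k => (#(A k), #(B k), #(C k))) = szs)
    {tbl : List (List ℕ × List ℕ)} (hdead : ∀ e ∈ tbl, CoverDead p N i szs e.1 e.2)
    (rows : ∀ h' ∈ List.range' 1 a, ∀ k ∈ List.range' 1 L, ∀ Q ∈ qShapes p b 0 ((p - 1).choose (b - 1)),
      dihedralSmaller p Q = true ∨ caseGDeadT p c z (a + L) ((List.range (a + 1)).filter fun x => !(Nat.beq x h'))
        (((List.range (L + 1)).filter fun x => !(Nat.beq x k)).map fun m => a + m) Q tbl = true) : False := by
  obtain ⟨β₀, hβ₀, ε, hε, hmin⟩ := exists_dihedralSmaller_false (hB i) d⁻¹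
  have hεd : (ε * d) ≠ 0 := mul_ne_zero (by rcases hε with rfl | rfl <;> simp) hd
  -- the progressions read with difference `ε·d`
  have hAP' : ∃ s, A i ⊆ apFinset s (ε * d) (a + 1) := by
    rcases hε with rfl | rfl
    · exact ⟨sA, by rwa [one_mul]⟩
    · refine ⟨sA + ((a + 1) - 1) • d, ?_⟩
      rw [neg_one_mul, ← Isoperimetric.apFinset_eq_apFinset_neg sA d (by omega)]; exact hAsub
  have hYP' : ∃ t, DU B C (univ.erase i) ⊆ apFinset t (ε * d) (L + 1) := by
    rcases hε with rfl | rfl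
    · exact ⟨tY, by rwa [one_mul]⟩
    · refine ⟨tY + ((L + 1) - 1) • d, ?_⟩
      rw [neg_one_mul, ← Isoperimetric.apFinset_eq_apFinset_neg tY d (by omega)]; exact hYsub
  obtain ⟨s', hAsub'⟩ := hAP'
  obtain ⟨t', hYsub'⟩ := hYP'
  have hinv : (ε * d)⁻¹ = ε * d⁻¹ := by
    rcases hε with rfl | rfl
    · rw [one_mul, one_mul]
    · rw [neg_one_mul, neg_one_mul, inv_neg]
  obtain ⟨h', k, h'1, h'a, hk1, hkL, key⟩ := caseGDeadT_false_of_HR hS hA hB hC i ha hc hz hL haL h1a h1L hεd hAsub' hYsub' hSY β₀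
    ks hks hksi hszs hdead
  rw [hinv] at key
  have hu0 : ε * d⁻¹ ≠ 0 := by rw [← hinv]; exact inv_ne_zero hεd
  rcases rows h' (List.mem_range'.2 ⟨h' - 1, by omega, by omega⟩) k (List.mem_range'.2 ⟨k - 1, by omega, by omega⟩) _
      (valShape_mem_qShapes hu0 hβ₀ hb) with h | h
  · rw [hmin] at h; exact Bool.noConfusion h
  · rw [key] at h; exact Bool.noConfusion h

/-! ## §2 The slack-4 law modulo cell (2,2) -/

/-- **THE SLACK-4 PARTITION LAW modulo its structure-free cell.**  For an STPP family of `ℤ/p` with `N ≥ 2` non-empty blocks, block `i` read `(a,b,c)`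
with `a, b, L, z ≥ 3`, `a + L, b + z ≥ 7`, at slack 4 (`z + b + vol + a + L + 2 = p`): the Vosper rows (`caseADeadT`, cells `δ₁ = 0` / `δ₂′ = 0`), the
Hamidoune–Rødseth rows (`caseGDeadT` over the hole pairs, cells `δ₁ = 1` / `δ₂′ = 1`), their dead tables, and the exclusion `h22` of the cell
`(#SY, #T) = (a + L + 1, b + z + 1)` are contradictory. [cite: CohnKleinbergSzegedyUmans2005, Def. 5.1] [cite: Vosper1956, main theorem; Nathanson1996, Thm 2.7]
[cite: HamidouneRodseth2000, main theorem (§1, p. 252)] -/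
theorem no_isSTPP_of_slack_four_tables_of_cell22 (hHR : HamidouneRodsethInverseTheorem) {N : ℕ} {A B C : Fin N → Finset (ZMod p)}
    (hS : IsSTPP A B C) (hA : ∀ k, (A k).Nonempty) (hB : ∀ k, (B k).Nonempty) (hC : ∀ k, (C k).Nonempty) (i : Fin N)
    (hI : ((univ : Finset (Fin N)).erase i).Nonempty) {a b c L z vol : ℕ} (ha : #(A i) = a) (hb : #(B i) = b) (hc : #(C i) = c)
    (hz : ∑ k ∈ univ.erase i, #(A k) * #(C k) = z) (hL : ∑ k ∈ univ.erase i, #(B k) * #(C k) = L)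
    (hvol : a * b * c = vol) (hslack : z + b + vol + a + L + 2 = p)
    (h3a : 3 ≤ a) (h3b : 3 ≤ b) (h3L : 3 ≤ L) (h3z : 3 ≤ z) (h7a : 7 ≤ a + L) (h7b : 7 ≤ b + z)
    (ks : List (Fin N)) (hks : ks.Nodup) (hksi : ∀ k, k ∈ ks ↔ k ≠ i) {szsA szsB : List (ℕ × ℕ × ℕ)}
    (hszsA : ks.map (fun k => (#(A k), #(B k), #(C k))) = szsA) (hszsB : ks.map (fun k => (#(B k), #(A k), #(C k))) = szsB)
    {tblA0 tblB0 tblA1 tblB1 : List (List ℕ × List ℕ)} (deadA0 : ∀ e ∈ tblA0, CoverDead p N i szsA e.1 e.2)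
    (deadB0 : ∀ e ∈ tblB0, CoverDead p N i szsB e.1 e.2) (deadA1 : ∀ e ∈ tblA1, CoverDead p N i szsA e.1 e.2)
    (deadB1 : ∀ e ∈ tblB1, CoverDead p N i szsB e.1 e.2)
    (rowsA0 : ∀ Q ∈ qShapes p b 0 ((p - 1).choose (b - 1)), dihedralSmaller p Q = true ∨ caseADeadT p a c L z Q tblA0 = true)
    (rowsB0 : ∀ Q ∈ qShapes p a 0 ((p - 1).choose (a - 1)), dihedralSmaller p Q = true ∨ caseADeadT p b c z L Q tblB0 = true)
    (rowsA1 : ∀ h' ∈ List.range' 1 a, ∀ k ∈ List.range' 1 L, ∀ Q ∈ qShapes p b 0 ((p - 1).choose (b - 1)),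
      dihedralSmaller p Q = true ∨ caseGDeadT p c z (a + L) ((List.range (a + 1)).filter fun x => !(Nat.beq x h'))
        (((List.range (L + 1)).filter fun x => !(Nat.beq x k)).map fun m => a + m) Q tblA1 = true)
    (rowsB1 : ∀ h' ∈ List.range' 1 b, ∀ k ∈ List.range' 1 z, ∀ Q ∈ qShapes p a 0 ((p - 1).choose (a - 1)),
      dihedralSmaller p Q = true ∨ caseGDeadT p c L (b + z) ((List.range (b + 1)).filter fun x => !(Nat.beq x h'))
        (((List.range (z + 1)).filter fun x => !(Nat.beq x k)).map fun m => b + m) Q tblB1 = true)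
    (h22 : #((A i).image (fun x => (0 : ZMod p) - x) + DU B C (univ.erase i)) = a + L + 1 →
      #((B i).image (fun x => (0 : ZMod p) - x) + DU A C (univ.erase i)) = b + z + 1 → False) : False := by
  have hvol' : #(A i) * #(B i) * #(C i) = vol := by rw [ha, hb, hc, hvol]
  have h1a : 1 ≤ a := by omega
  have h1b : 1 ≤ b := by omega
  -- the dual chain at slack 4 and Cauchy–Davenport on both pairs
  have hsum := card_SY_add_card_T_le_of_slack hS i (s := 4) hvol' hz hL (by omega) h1a h1b
  have hge1 := card_add_sum_le_card_negA_add_DU hS hA hB hC i hI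
  have hge2 := card_add_sum_le_card_negB_add_DU hS hA hB hC i hI
  rw [ha, hL] at hge1
  rw [hb, hz] at hge2
  set nSY := #((A i).image (fun x => (0 : ZMod p) - x) + DU B C (univ.erase i)) with hnSY
  set nT := #((B i).image (fun x => (0 : ZMod p) - x) + DU A C (univ.erase i)) with hnT
  have hScard : #((A i).image fun x => (0 : ZMod p) - x) = a := by rw [Finset.card_image_of_injective _ sub_right_injective, ha]
  have hTcard : #((B i).image fun x => (0 : ZMod p) - x) = b := by rw [Finset.card_image_of_injective _ sub_right_injective, hb]
  have hYcard : #(DU B C (univ.erase i)) = L := by rw [card_DU_BC hS hA, hL]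
  have hZcard : #(DU A C (univ.erase i)) = z := by rw [card_DU_AC hS hB, hz]
  have hS' : IsSTPP B A C := STPP222SqNeg.isSTPP_swapBC (stpp_rotate hS)
  by_cases c1 : nSY = a + L - 1
  · -- Vosper on `(−Aᵢ, Y°)`
    obtain ⟨d, hd, hSap, hYap⟩ := vosper_inverse (A := (A i).image fun x => (0 : ZMod p) - x) (B := DU B C (univ.erase i))
      (by rw [hScard]; omega) (by rw [hYcard]; omega) (by rw [hScard, hYcard]; exact c1) (by rw [← hnSY]; omega)
    have hAap : IsAP (A i) d := by
      have h := hSap.neg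
      rwa [image_zero_sub_eq_neg, neg_neg] at h
    exact false_of_isAP_rowsA hS hA hB hC i hI ha hb hc hz hL (by omega) hd hAap hYap ks hks hksi hszsA deadA0 rowsA0
  by_cases c2 : nT = b + z - 1
  · -- Vosper on `(−Bᵢ, Z°)`: the role-swapped family
    obtain ⟨e, he, hTap, hZap⟩ := vosper_inverse (A := (B i).image fun x => (0 : ZMod p) - x) (B := DU A C (univ.erase i))
      (by rw [hTcard]; omega) (by rw [hZcard]; omega) (by rw [hTcard, hZcard]; exact c2) (by rw [← hnT]; omega)
    have hBap : IsAP (B i) e := by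
      have h := hTap.neg
      rwa [image_zero_sub_eq_neg, neg_neg] at h
    exact false_of_isAP_rowsA hS' hB hA hC i hI hb ha hc hL hz (by omega) he hBap hZap ks hks hksi hszsB deadB0 rowsB0
  by_cases c3 : nSY = a + L
  · -- Hamidoune–Rødseth on `(−Aᵢ, Y°)`
    obtain ⟨d, s, t, hSsub, hYsub⟩ := hHR p ((A i).image fun x => (0 : ZMod p) - x) (DU B C (univ.erase i))
      (by rw [hScard]; exact h3a) (by rw [hYcard]; exact h3L) (by rw [← hnSY]; omega) (by rw [← hnSY]; omega)
      (by rw [← hnSY, hScard, hYcard]; omega)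
    rw [hScard] at hSsub
    rw [hYcard] at hYsub
    have hd : d ≠ 0 := step_ne_zero_of_subset_apFinset hSsub (by rw [hScard]; omega)
    exact false_of_HR_rowsA1 hS hA hB hC i ha hb hc hz hL (by omega) h1a (by omega) hd
      (subset_apFinset_of_image_zero_sub_subset hSsub) hYsub c3 ks hks hksi hszsA deadA1 rowsA1
  by_cases c4 : nT = b + z
  · -- Hamidoune–Rødseth on `(−Bᵢ, Z°)`: the role-swapped family
    obtain ⟨e, s, t, hTsub, hZsub⟩ := hHR p ((B i).image fun x => (0 : ZMod p) - x) (DU A C (univ.erase i))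
      (by rw [hTcard]; exact h3b) (by rw [hZcard]; exact h3z) (by rw [← hnT]; omega) (by rw [← hnT]; omega)
      (by rw [← hnT, hTcard, hZcard]; omega)
    rw [hTcard] at hTsub
    rw [hZcard] at hZsub
    have he : e ≠ 0 := step_ne_zero_of_subset_apFinset hTsub (by rw [hTcard]; omega)
    exact false_of_HR_rowsA1 hS' hB hA hC i hb ha hc hL hz (by omega) h1b (by omega) he
      (subset_apFinset_of_image_zero_sub_subset hTsub) hZsub c4 ks hks hksi hszsB deadB1 rowsB1
  · -- the structure-free cell
    exact h22 (by omega) (by omega)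

end Summit.MatrixMultiplication.OmegaCensus.CubeNB.S2
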